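import Summits.NavierStokesRegularity.NavierStokesRegularity.Theorems.PerpetualPumpCircuitPumpIntoLemmas
import Summits.NavierStokesRegularity.NavierStokesRegularity.Theorems.PerpetualPumpCircuitPumpIntoTrail
import Summits.NavierStokesRegularity.NavierStokesRegularity.Theorems.PerpetualPumpCircuitPumpClockBoxWindow

/-!
# `PerpetualPump.CircuitPump` (stmt-NavierStokesRegularity-1834), line `singular-clock-gspt`:
# INTO for the Toda clock box

Sub-goal `toda_into` of `stub_clockBox` (Toda `m = 2` instance of the seeded graded Toda pump,
`q = lam^{1/5}`, `ν = lam^{4/5}`, `r = lam^{-4/5}`, `Λ = -log ε`). Given a solution of the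
`L`-truncated system on `[0, Tmax]` started in the clock box, the a-priori corridor
(`b 1 ≤ 1/4`, `b (-1) ≤ 1`, `|a 2| ≤ 1`) and the pre-gate sup of the new bond, at every section time
`T ∈ [T₁(A), T₂(A)]` each renormalised mode `q · (mode n+1)` lands in the box of scale `n`:
the spent active pair by `toda_active_core` (`|u| ≤ 13`, `v ≤ 31/A`), the trail by
`toda_trail_slaving` / `toda_trail_bonds_deep` and the design `E_{j+1} - E_j = κ Tmax r^{j-1}` of the
bond boxes, the precursors by `toda_precursor_tower` / `toda_precursor_signed` under the sharp driver
bound `b 1 ≤ ε^{9/20} A₂^{28} e^{548}` obtained from the shifted phase III clock `activeClock_star` and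
the window fact `lam W⁺ Δ⁺ ≤ (11/20) Λ + 100`. Pure real analysis. [folklore]
-/

set_option linter.dupNamespace false

noncomputable section

open Set

namespace Summit.NavierStokesRegularity.NavierStokesRegularity.Theorems.PerpetualPumpCircuitPump

/-- The window facts at an amplitude `A ∈ [A₁, A₂]` used by INTO (from `toda_clockBox_window`,
`clockBox_consts`, `clockBox_point`): sizes of `A`, `0 < x(A) < 1` for `x = (ℓ₁ + 11/5)/A`,
`0 < Tmax ≤ 1/8`, `0 < T₁(A)`, `t₃(A) < T₁(A) ≤ T₂(A) ≤ Tmax`, `0 ≤ lam W⁺(A)` and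
`lam W⁺(A) Δ⁺(A) ≤ (11/20) Λ + 100`. [folklore] -/
theorem into_point {lam ν q ε Λ As A₁ A₂ Tmax A : ℝ} (hlam : 1 < lam) (hlam2 : lam ≤ 3 / 2)
    (hν : ν = lam ^ (4 / 5 : ℝ)) (hq : q = lam ^ (1 / 5 : ℝ)) (hε : 0 < ε) (hΛ : Λ = -Real.log ε)
    (hAs : As = (q + 1) * Λ / (2 * (q - 1))) (hA₁ : A₁ = 9 / 10 * As) (hA₂ : A₂ = 11 / 10 * As)
    (h40000 : 40000 ≤ A₁) (HBIG : 100000 * (Real.log A₂ + 500) ≤ Λ)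
    (hTmax : Tmax = (-Real.log (1 - (((Λ) / 2 + Real.log (A₂ / 8)) + 11 / 5) / A₁) + (250 + 16 * Real.log A₂) / A₁ + (-(1 / ν) * Real.log (1 - ν * ((Λ) / 2 - Real.log q + 73) / (lam * (A₁ - ((Λ) / 2 + Real.log (A₁ / 8)) - 903 - 50 * Real.log A₁))))))
    (hAlo : A₁ ≤ A) (hAhi : A ≤ A₂) :
    0 < A₁ ∧ 40000 ≤ A ∧ Λ ≤ A / 5 ∧ ε * (A + 2) ^ 2 ≤ 1 ∧ Real.sqrt ε * A ≤ 1 / 40 ∧ 1 ≤ A₂ ∧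
    0 < (((Λ) / 2 + Real.log (A / 8)) + 11 / 5) / A ∧ (((Λ) / 2 + Real.log (A / 8)) + 11 / 5) / A < 1 ∧
    0 < Tmax ∧ Tmax ≤ 1 / 8 ∧
    0 < ((-Real.log (1 - (((Λ) / 2 + Real.log (A / 8)) + 11 / 5) / A)) + (250 + 16 * Real.log A) / A) + (-(1 / ν) * Real.log (1 - ν * ((Λ) / 2 - Real.log q - 28 * Real.log A - 449) / (lam * (A - ((Λ) / 2 + Real.log (A / 8)) + 903 + 50 * Real.log A)))) ∧
    ((-Real.log (1 - (((Λ) / 2 + Real.log (A / 8)) + 11 / 5) / A)) + (250 + 16 * Real.log A) / A) < ((-Real.log (1 - (((Λ) / 2 + Real.log (A / 8)) + 11 / 5) / A)) + (250 + 16 * Real.log A) / A) + (-(1 / ν) * Real.log (1 - ν * ((Λ) / 2 - Real.log q - 28 * Real.log A - 449) / (lam * (A - ((Λ) / 2 + Real.log (A / 8)) + 903 + 50 * Real.log A)))) ∧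
    ((-Real.log (1 - (((Λ) / 2 + Real.log (A / 8)) + 11 / 5) / A)) + (250 + 16 * Real.log A) / A) + (-(1 / ν) * Real.log (1 - ν * ((Λ) / 2 - Real.log q - 28 * Real.log A - 449) / (lam * (A - ((Λ) / 2 + Real.log (A / 8)) + 903 + 50 * Real.log A)))) ≤ ((-Real.log (1 - (((Λ) / 2 + Real.log (A / 8)) + 11 / 5) / A)) + (250 + 16 * Real.log A) / A) + (-(1 / ν) * Real.log (1 - ν * ((Λ) / 2 - Real.log q + 73) / (lam * (A - ((Λ) / 2 + Real.log (A / 8)) - 903 - 50 * Real.log A)))) ∧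
    ((-Real.log (1 - (((Λ) / 2 + Real.log (A / 8)) + 11 / 5) / A)) + (250 + 16 * Real.log A) / A) + (-(1 / ν) * Real.log (1 - ν * ((Λ) / 2 - Real.log q + 73) / (lam * (A - ((Λ) / 2 + Real.log (A / 8)) - 903 - 50 * Real.log A)))) ≤ Tmax ∧
    0 ≤ lam * (A - ((Λ) / 2 + Real.log (A / 8)) + 903 + 50 * Real.log A) ∧
    lam * (A - ((Λ) / 2 + Real.log (A / 8)) + 903 + 50 * Real.log A) * (-(1 / ν) * Real.log (1 - ν * ((Λ) / 2 - Real.log q + 73) / (lam * (A - ((Λ) / 2 + Real.log (A / 8)) - 903 - 50 * Real.log A)))) ≤ 11 / 20 * Λ + 100 := by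
  obtain ⟨-, hTmin0, hTmax8, hwin, hpt⟩ :=
    toda_clockBox_window lam ν q ε Λ As A₁ A₂ hlam hlam2 hν hq hε hΛ hAs hA₁ hA₂ h40000 HBIG
  obtain ⟨hT1lo, hT12, hT2hi⟩ := hwin A ⟨hAlo, hAhi⟩
  obtain ⟨hA4, hΛA, hεA, hsA, hlogA, -, hΔm, -, -, hWΔ, -⟩ := hpt A ⟨hAlo, hAhi⟩
  obtain ⟨-, -, -, -, -, hlq0, hlq1⟩ := activeClock_consts hlam hlam2 hν hq
  obtain ⟨-, -, hAs0, hΛ0, hΛAs, -, hA₁0, hA₁₂, hLA₂, -⟩ :=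
    clockBox_consts hlam hlam2 hν hq hAs hA₁ hA₂ h40000 HBIG
  obtain ⟨μ, hμ, hμ0, hμ1⟩ : ∃ μ : ℝ, Λ = μ * As ∧ 0 < μ ∧ μ ≤ 811 / 10000 :=
    ⟨Λ / As, by field_simp, div_pos hΛ0 hAs0, by rwa [div_le_iff₀ hAs0]⟩
  have hlogAb : Real.log A ≤ Λ / 100000 - 500 :=
    (Real.log_le_log (by linarith) hAhi).trans hLA₂
  obtain ⟨-, -, -, hx0, -, hx1, hWm, -, -, -, -, -, -⟩ := clockBox_point q Λ As μ A hlq0 hlq1 hAs0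
    hμ hμ0 hμ1 (by rw [← hA₁]; exact hAlo) (by rw [← hA₂]; exact hAhi) hA4 hlogAb
  rw [← hTmax] at hTmax8 hT2hi
  have hμ' : 0 < 5 / 11 * μ := by positivity
  have hlam0 : 0 < lam := by linarith
  refine ⟨hA₁0, hA4, hΛA, hεA, hsA, by linarith, by linarith, by linarith, by linarith, hTmax8,
    hTmin0.trans_le hT1lo, lt_add_of_pos_right _ hΔm, hT12, hT2hi, mul_nonneg hlam0.le (by linarith),
    hWΔ⟩

/-- **INTO for the Toda clock box.** Given the corridor on `[0,Tmax]` (from `toda_boot`) and the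
pre-gate sup of the new bond (from `toda_active_zsup`), for every section time `T` in the window
`[T₁(A), T₂(A)]` every renormalised mode one scale up lands in the box of the scale below: the trail by
`toda_trail_slaving` + `toda_trail_bonds_deep` and the design of the bond boxes `σ_j`; the spent active
pair by `toda_active_core` (`|u| ≤ 13`, `v ≤ 31/A`); the precursors by `toda_precursor_tower` /
`toda_precursor_signed` with the sharp driver bound `ε^{9/20} A₂^{28} e^{548}` from `activeClock_star`
and `lam W⁺ Δ⁺ ≤ (11/20) Λ + 100`. -/
theorem toda_into :
    ∀ (lam ν q r ε Λ As A₁ A₂ Tmax : ℝ),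
    1 < lam → lam ≤ 3 / 2 → ν = lam ^ (4 / 5 : ℝ) → q = lam ^ (1 / 5 : ℝ) → r = lam ^ (-(4 / 5 : ℝ)) →
    0 < ε → Λ = -Real.log ε → As = (q + 1) * Λ / (2 * (q - 1)) → A₁ = 9 / 10 * As → A₂ = 11 / 10 * As →
    40000 ≤ A₁ → 100000 * (Real.log A₂ + 500) ≤ Λ →
    Tmax = (-Real.log (1 - (((Λ) / 2 + Real.log (A₂ / 8)) + 11 / 5) / A₁) + (250 + 16 * Real.log A₂) / A₁ + (-(1 / ν) * Real.log (1 - ν * ((Λ) / 2 - Real.log q + 73) / (lam * (A₁ - ((Λ) / 2 + Real.log (A₁ / 8)) - 903 - 50 * Real.log A₁))))) →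
    ε ≤ 1 / 100000 →
    (40 * q / A₁ + 4 * ε * 169 * q * Tmax) * Real.exp (65 * Tmax) ≤ 1 / 2 →
    A₂ ^ 2 * ε ^ (3 / 20 : ℝ) ≤ 1 / 2 →
    2 * (40 / A₁ * Real.exp ((65 + 169 / 10 * ε * A₁) * Tmax / (1 - r)) + 4 * ε * 169 * Tmax) ^ 2 *
      Real.exp (130 * Tmax) * Tmax ≤ 13 * (1 - r) →
    40 / A₁ * Real.exp ((65 + 169 / 10 * ε * A₁) * Tmax / (1 - r)) ≤ 1 / 1000 →
    q * (ε ^ 2 / (4 * lam ^ 2) + lam * (ε ^ (9 / 20 : ℝ) * A₂ ^ 28 * Real.exp 548) ^ 2 * Tmax + 28 * ε ^ 3 * Tmax) ≤ ε ^ (3 / 4 : ℝ) →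
    18 * ε * (ε ^ 2 + 4 * lam ^ 3 * (ε ^ (9 / 20 : ℝ) * A₂ ^ 28 * Real.exp 548) ^ 2 * Tmax) ^ 2 ≤ ε ^ (3 / 2 : ℝ) →
    ∀ (L : ℕ) (A : ℝ) (a b : ℤ → ℝ → ℝ), 2 ≤ L →
    a 0 0 = A → A₁ ≤ A → A ≤ A₂ → b 0 0 = Real.sqrt ε → -ε ^ 2 ≤ a 1 0 → a 1 0 ≤ ε ^ (3 / 4 : ℝ) →
    0 ≤ b 1 0 → b 1 0 ≤ ε ^ (3 / 2 : ℝ) → (∀ n : ℤ, 0 ≤ b n 0) →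
    (∀ n : ℤ, 2 ≤ n → |a n 0| ≤ ε ^ 2 * (2 * lam) ^ (-(n : ℝ)) ∧ b n 0 ≤ ε ^ (3 / 2 : ℝ) * (2 * lam) ^ (-(n : ℝ))) →
    (∀ n : ℤ, n ≤ -1 → |a n 0| ≤ 13 * lam ^ (-(n : ℝ) / 5) * (2 - lam ^ ((4 / 5 : ℝ) * n)) ∧
      b n 0 ≤ 40 / A₁ * lam ^ (-(n : ℝ) / 5) * Real.exp ((65 + 169 / 10 * ε * A₁) * Tmax * (1 - lam ^ ((4 / 5 : ℝ) * (n + 1))) / (1 - r))) →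
    (∀ n : ℤ, (L : ℤ) < |n| → ∀ t ∈ Set.Icc 0 Tmax, a n t = 0 ∧ b n t = 0) → (∀ n : ℤ, |n| ≤ (L : ℤ) → ContinuousOn (a n) (Set.Icc 0 Tmax) ∧ ContinuousOn (b n) (Set.Icc 0 Tmax)) → (∀ n : ℤ, |n| ≤ (L : ℤ) → ∀ t ∈ Set.Ico 0 Tmax, HasDerivWithinAt (a n) (-(lam ^ ((4 / 5 : ℝ) * n)) * a n t - lam ^ (n : ℝ) * b n t ^ 2 + lam ^ ((n : ℝ) - 1) * b (n - 1) t ^ 2 - ε * lam ^ (n : ℝ) * a n t * b n t) (Set.Ici t) t ∧ HasDerivWithinAt (b n) (-(lam ^ ((4 / 5 : ℝ) * n)) * b n t + lam ^ (n : ℝ) * b n t * (a n t - a (n + 1) t) + ε * lam ^ (n : ℝ) * a n t ^ 2) (Set.Ici t) t) →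
    (∀ t ∈ Set.Icc 0 Tmax, b 1 t ≤ 1 / 4 ∧ b (-1) t ≤ 1 ∧ |a 2 t| ≤ 1) →
    (∀ t ∈ Set.Icc 0 Tmax, t ≤ ((-Real.log (1 - (((Λ) / 2 + Real.log (A / 8)) + 11 / 5) / A)) + (250 + 16 * Real.log A) / A) → b 1 t ≤ ε * A ^ 27 * Real.exp 400) →
    (∀ T ∈ Set.Icc (((-Real.log (1 - (((Λ) / 2 + Real.log (A / 8)) + 11 / 5) / A)) + (250 + 16 * Real.log A) / A) + (-(1 / ν) * Real.log (1 - ν * ((Λ) / 2 - Real.log q - 28 * Real.log A - 449) / (lam * (A - ((Λ) / 2 + Real.log (A / 8)) + 903 + 50 * Real.log A))))) (((-Real.log (1 - (((Λ) / 2 + Real.log (A / 8)) + 11 / 5) / A)) + (250 + 16 * Real.log A) / A) + (-(1 / ν) * Real.log (1 - ν * ((Λ) / 2 - Real.log q + 73) / (lam * (A - ((Λ) / 2 + Real.log (A / 8)) - 903 - 50 * Real.log A))))),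
      (∀ n : ℤ, n ≤ -1 → -(L : ℤ) ≤ n → |q * a (n + 1) T| ≤ 13 * lam ^ (-(n : ℝ) / 5) * (2 - lam ^ ((4 / 5 : ℝ) * n)) ∧
        0 ≤ q * b (n + 1) T ∧ q * b (n + 1) T ≤ 40 / A₁ * lam ^ (-(n : ℝ) / 5) * Real.exp ((65 + 169 / 10 * ε * A₁) * Tmax * (1 - lam ^ ((4 / 5 : ℝ) * (n + 1))) / (1 - r))) ∧
      (-ε ^ 2 ≤ q * a 2 T ∧ q * a 2 T ≤ ε ^ (3 / 4 : ℝ) ∧ 0 ≤ q * b 2 T ∧ q * b 2 T ≤ ε ^ (3 / 2 : ℝ)) ∧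
      (∀ n : ℤ, 2 ≤ n → n ≤ (L : ℤ) → |q * a (n + 1) T| ≤ ε ^ 2 * (2 * lam) ^ (-(n : ℝ)) ∧
        0 ≤ q * b (n + 1) T ∧ q * b (n + 1) T ≤ ε ^ (3 / 2 : ℝ) * (2 * lam) ^ (-(n : ℝ)))) := by
  intro lam ν q r ε Λ As A₁ A₂ Tmax hlam hlam2 hν hq hr hε hΛ hAs hA₁ hA₂ h40000 HBIG hTmax hε1 _ _
    HS5 _ HS6 HS7 L A a b hL ha00 hAlo hAhi hb00 ha10lo ha10hi hb10lo hb10hi hb0 hpre htrail hzero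
    hcont hderiv hcorr hzsup T hT
  obtain ⟨hA₁0, hA4, hΛA, hεA, hsA, -, hx0, hx1, hTmax0, hTmax8, hT₁0, ht₃T₁, -, hT2max, hlW,
    hWΔ⟩ := into_point hlam hlam2 hν hq hε hΛ hAs hA₁ hA₂ h40000 HBIG hTmax hAlo hAhi
  have hlam0 : 0 < lam := by linarith
  have hε1' : ε ≤ 1 := by linarith
  have hTmax2 : Tmax ≤ 1 / 2 := by linarith
  have hT0 : 0 < T := hT₁0.trans_le hT.1
  have hTT : T ≤ Tmax := hT.2.trans hT2max
  have hTI : T ∈ Icc 0 Tmax := ⟨hT0.le, hTT⟩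
  have ht₃T := ht₃T₁.trans_le hT.1
  have ht₃max := ht₃T.trans_le hTT
  -- all bonds stay non-negative
  obtain ⟨hbnn, -⟩ := toda_trunc_structure lam ε Tmax L a b hlam0 hε.le hTmax0 hzero hcont hderiv hb0
  -- the active block on `[0, Tmax]`
  obtain ⟨-, hu13, huv, hzlog⟩ := into_core lam ν ε Λ A Tmax _ L a b hlam hlam2 hν hε hΛ hTmax0
    hTmax2 hA4 hΛA hεA hsA rfl hx0 hx1 ht₃max hL ha00 hb00 ha10lo ha10hi hb10lo hb10hi hcont hderiv
    hcorr (fun t ht => hbnn (-1) t ht)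
  -- the driver bound on `[0, T]` and the precursor tower
  have hdrive : ∀ t ∈ Icc 0 T, b 1 t ≤ ε ^ (9 / 20 : ℝ) * A₂ ^ 28 * Real.exp 548 :=
    into_driver hε hε1' hΛ (by linarith) hAhi rfl (fun t ht hle => hzsup t ⟨ht.1, ht.2.trans hTT⟩ hle)
      (fun t ht => hzlog t ⟨ht.1, ht.2.trans hTT⟩) hWΔ (sub_le_iff_le_add'.mpr hT.2) hlW
  have htow := into_tower hlam (by linarith) hε hε1 hT0 hTT hTmax8 (by positivity) HS7 hzero hcont
    hderiv hb0 hdrive hpre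
  -- the trail on `[0, Tmax]`
  obtain ⟨hbj, hbdj⟩ := into_trail_apply hlam hlam2 hr hε.le hε1' hTmax0 hTmax2 hA₁0 rfl rfl HS5
    hzero hcont hderiv hb0 hu13 htrail T hTI
  obtain ⟨hu, hv⟩ := huv T ⟨ht₃T.le, hTT⟩
  obtain ⟨h2, h3⟩ := into_prec hlam hlam2 hq hε hε1 hT0.le hTT hTmax8 HS6 hpre htow
  exact ⟨fun n hn _ => into_trail lam q r ε A₁ A T Tmax _ _ a b hlam hq hr hε.le hA₁0 hAlo hT0.le
    hTT rfl (by positivity) HS5 htrail hbj hbdj hu (hbnn 0 T hTI) hv n hn, h2, fun n hn _ => h3 n hn⟩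

end Summit.NavierStokesRegularity.NavierStokesRegularity.Theorems.PerpetualPumpCircuitPump
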